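import Summits.ResolutionOfSingularities.ResolutionOfSingularities.Theorems.HilbertSamuelEliminationSigmaMaxModificationsCorridor3SigmaMenuSurfacePointStepF75
import Mathlib.Topology.GDelta.Basic
import HarnessLib

/-!
# [OURS · L1 W4.2] σ-LAYER PHASE B′ — `Corridor3SigmaSurfaceTraceSetNowhereDense`: the filtered trace configuration `S(E, D)` of an IRREDUCIBLE surface is NOWHERE
# DENSE in the reduced surface (every kept member misses the generic point), so the F-75/F-75c feed of the point step needs no separate «nowhere dense» premise
# (crux chain w42 `SigmaMaxModifications` stmt-ResolutionOfSingularities-18506 / conjunct `SigmaMaxModificationsCorridor3` stmt-ResolutionOfSingularities-19249; helper of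
# res-L1-w42-stub-1 (gen 5), `--supports stmt-…-19249 --as helper`, counted 0)

HONEST FRAMING. OURS bookkeeping (point-set topology + this seat's p545860 `exists_pointStepOfRecord_of_not_isSNC`). NOTHING here is a statement of H. Hironaka's
manuscript [Hironaka2017] nor of [CossartJannsenSaito2020]; F-75c enters as the hypothesis `hF`. AI-written; AI review is weaker than expert review.

## Contents (namespace `…Theorems.SigmaMaxModificationsCorridor3.Sigma`)

* topology: `isNowhereDense_of_isClosed_of_ne_univ` (proper closed subsets of a preirreducible space), `IsNowhereDense.union_of_isClosed`,
  `Boundary.isNowhereDense_divisorSet` (finite unions of nowhere dense closed supports);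
* `Boundary.isNowhereDense_divisorSet_restrictOff` (the filtered traces along a morphism from a preirreducible scheme), **`isNowhereDense_surfaceTraceSet`**
  (`D` irreducible);
* **`exists_pointStepOfRecord_of_not_isSNC'`** / `surfaceSncLength_pos_iff'` — p545860 with the nowhere-dense premise DISCHARGED (hypotheses: F-75c, `D̃` Noetherian
  regular excellent of dimension `2`, `D` irreducible, configuration not snc).

VACUITY SELF-CHECK. Pure topology + instantiation; `D` irreducible holds for every surface component of `X(ν)`.
-/

noncomputable section

set_option linter.dupNamespace false -- mandated namespace of this single-conjunct summit

open CategoryTheory AlgebraicGeometry TopologicalSpace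
open Summit.ResolutionOfSingularities.ResolutionOfSingularities.Theorems.CampaignW42
open Literature.AlgebraicGeometry.Resolution Literature.RingTheory.HilbertSamuel

namespace Summit.ResolutionOfSingularities.ResolutionOfSingularities.Theorems.SigmaMaxModificationsCorridor3.Sigma

universe u

open Scheme.IdealSheafData

/-! ## Topology: nowhere dense closed sets -/

section Topology

variable {X : Type*} [TopologicalSpace X]

/-- **A proper closed subset of a (pre)irreducible space is nowhere dense** (its complement is a non-empty open, hence dense). [folklore] -/
theorem isNowhereDense_of_isClosed_of_ne_univ [PreirreducibleSpace X] {A : Set X} (hA : IsClosed A) (hne : A ≠ Set.univ) : IsNowhereDense A := by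
  have h : IsOpen Aᶜ ∧ Dense Aᶜ := ⟨hA.isOpen_compl, hA.isOpen_compl.dense (Set.nonempty_compl.mpr hne)⟩
  exact (isClosed_isNowhereDense_iff_compl.mpr h).2

/-- **The union of two closed nowhere dense sets is nowhere dense** (the complements are dense opens, whose intersection is dense). [folklore] -/
theorem IsNowhereDense.union_of_isClosed {A B : Set X} (hA : IsClosed A) (hB : IsClosed B) (ha : IsNowhereDense A) (hb : IsNowhereDense B) :
    IsNowhereDense (A ∪ B) := by
  obtain ⟨hAo, hAd⟩ := isClosed_isNowhereDense_iff_compl.mp ⟨hA, ha⟩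
  obtain ⟨hBo, hBd⟩ := isClosed_isNowhereDense_iff_compl.mp ⟨hB, hb⟩
  have h : IsOpen (A ∪ B)ᶜ ∧ Dense (A ∪ B)ᶜ := by
    rw [Set.compl_union]
    exact ⟨hAo.inter hBo, hAd.inter_of_isOpen_left hBd hAo⟩
  exact (isClosed_isNowhereDense_iff_compl.mpr h).2

end Topology

/-! ## Divisor sets of boundaries with nowhere dense members -/

section DivisorSet

variable {W D : Scheme.{u}}

/-- The divisor set of `Γ :: Γs`. [folklore] -/
theorem Boundary.divisorSet_cons (Γ : D.IdealSheafData) (Γs : Boundary D) : Boundary.divisorSet (Γ :: Γs) = (Γ.support : Set D) ∪ Γs.divisorSet := by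
  ext x
  simp only [Boundary.mem_divisorSet_iff, List.mem_cons, Set.mem_union, SetLike.mem_coe]
  constructor
  · rintro ⟨I, rfl | hI, hx⟩
    · exact Or.inl hx
    · exact Or.inr ⟨I, hI, hx⟩
  · rintro (hx | ⟨I, hI, hx⟩)
    · exact ⟨Γ, Or.inl rfl, hx⟩
    · exact ⟨I, Or.inr hI, hx⟩

/-- **A finite union of nowhere dense (closed) supports is nowhere dense.** [folklore] -/
theorem Boundary.isNowhereDense_divisorSet (Γs : Boundary D) (h : ∀ Γ ∈ Γs, IsNowhereDense (Γ.support : Set D)) : IsNowhereDense Γs.divisorSet := by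
  induction Γs with
  | nil => rw [Boundary.divisorSet_nil]; exact isNowhereDense_empty
  | cons Γ Γs ih =>
    rw [Boundary.divisorSet_cons]
    exact IsNowhereDense.union_of_isClosed Γ.support.isClosed (Boundary.isClosed_divisorSet Γs) (h Γ (by simp))
      (ih fun Γ' hΓ' => h Γ' (by simp [hΓ']))

/-- **The filtered traces are nowhere dense** on a preirreducible `D`: a kept member does not contain the image of `ι`, so its trace is a proper closed subset.
[folklore] -/
theorem Boundary.isNowhereDense_divisorSet_restrictOff [PreirreducibleSpace D] (E : Boundary W) (ι : D ⟶ W) :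
    IsNowhereDense (E.restrictOff ι).divisorSet := by
  refine Boundary.isNowhereDense_divisorSet _ fun Γ hΓ => ?_
  obtain ⟨I, -, hI, rfl⟩ := Boundary.mem_restrictOff_iff.mp hΓ
  refine isNowhereDense_of_isClosed_of_ne_univ (I.comap ι).support.isClosed fun huniv => hI ?_
  rintro _ ⟨y, rfl⟩
  have hy : y ∈ ((I.comap ι).support : Set D) := huniv ▸ Set.mem_univ y
  rwa [Boundary.coe_support_comap] at hy

/-- **THE TRACE CONFIGURATION OF AN IRREDUCIBLE SURFACE IS NOWHERE DENSE** in its reduced surface `D̃`. [folklore] -/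
theorem isNowhereDense_surfaceTraceSet (E : Boundary W) {D : Closeds W} (hDirr : IsIrreducible (D : Set W)) : IsNowhereDense (surfaceTraceSet E D) := by
  haveI : IsIntegral (menuCentre D).subscheme := isIntegral_subscheme_vanishingIdeal D hDirr
  exact Boundary.isNowhereDense_divisorSet_restrictOff E _

end DivisorSet

/-! ## The F-75c feed without the nowhere-dense premise -/

section Feed

variable {W : Scheme.{u}}

/-- **F-75c ⇒ `0 < ℓ(E, D)` iff the configuration is not snc**, for an irreducible surface `D` with Noetherian, regular, excellent, 2-dimensional `D̃` (the nowhere-dense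
premise of p545860 discharged by `isNowhereDense_surfaceTraceSet`). [folklore] -/
theorem surfaceSncLength_pos_iff' (hF : Stacks0BIC_embeddedResolutionCurvesInSurfaces_locus.{u}) (E : Boundary W) (D : Closeds W) (hDirr : IsIrreducible (D : Set W))
    [IsNoetherian (menuCentre D).subscheme] (hreg : Scheme.IsRegular (menuCentre D).subscheme) (hexc : Scheme.IsExcellent (menuCentre D).subscheme)
    (hdim : topologicalKrullDim ↥(menuCentre D).subscheme = 2) :
    0 < surfaceSncLength E D ↔ ¬ IsStrictNormalCrossingsDivisor (menuCentre D).subscheme (surfaceTraceSet E D) :=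
  surfaceSncLength_pos_iff_of_stacks0BIC_locus hF E D hreg hexc hdim (isNowhereDense_surfaceTraceSet E hDirr)

/-- **THE POINT STEP SPEAKS ON EVERY NON-SNC CONFIGURATION OF AN IRREDUCIBLE REGULAR EXCELLENT SURFACE (modulo F-75c)** — p545860 with the nowhere-dense premise
discharged. [folklore] -/
theorem exists_pointStepOfRecord_of_not_isSNC' (hF : Stacks0BIC_embeddedResolutionCurvesInSurfaces_locus.{u}) {hW : IsLocallyNoetherian W} {N : ℕ} {ν : ℕ → ℕ}
    {L : Labelling W} {P : Option (Pending W)} (E : Boundary W) (D : Closeds W) (hDirr : IsIrreducible (D : Set W)) [IsNoetherian (menuCentre D).subscheme]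
    (hreg : Scheme.IsRegular (menuCentre D).subscheme) (hexc : Scheme.IsExcellent (menuCentre D).subscheme) (hdim : topologicalKrullDim ↥(menuCentre D).subscheme = 2)
    (hnot : ¬ IsStrictNormalCrossingsDivisor (menuCentre D).subscheme (surfaceTraceSet E D)) : ∃ C : W.IdealSheafData, pointStepOfRecord W hW N ν L P E D C :=
  exists_pointStepOfRecord_of_not_isSNC hF E D hreg hexc hdim (isNowhereDense_surfaceTraceSet E hDirr) hnot

end Feed

end Summit.ResolutionOfSingularities.ResolutionOfSingularities.Theorems.SigmaMaxModificationsCorridor3.Sigma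

end
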